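import Summits.CriticalPhenomena.CardyFormulaZ2.Theses.CardyBondTriangular
import Summits.CriticalPhenomena.CardyFormulaZ2.Theses.CardyIsoradial
import Summits.CriticalPhenomena.CardyFormulaZ2.Theorems.CardyIKTransportCrudeToCanonical
import Summits.CriticalPhenomena.CardyFormulaZ2.Theorems.CardyMeckeFlipLawToCrossingsUpper
import Summits.CriticalPhenomena.CardyFormulaZ2.Theorems.CardyBondTriangularDiscretisationBridgeStubDiscreteLeCrude
import Summits.CriticalPhenomena.CardyFormulaZ2.Theorems.CardyBondTriangularDiscretisationBridgeStubCrossedSubsetDiscrete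
import Summits.CriticalPhenomena.CardyFormulaZ2.Theorems.CardyBondTriangularDiscretisationBridgeStubStrictlyDominatedShrink
import Summits.CriticalPhenomena.CardyFormulaZ2.Theorems.CardyBondTriangularDiscretisationBridgeStubStrictlyDominatedStretch
import Literature.Probability.Percolation.QuadCrossingContinuityOfLemma51
import Literature.Probability.Percolation.QuadCrossingContinuityEventsDischarge

/-!
# `DiscretisationBridge` (stmt-CriticalPhenomena-0787): crude Cardy on `ℤ²` implies G02 Cardy, per rectangle

Route `route-CriticalPhenomena-CardyBondTriangular` (item shared verbatim with CardyIsoradial and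
four other routes), sub-problem `CardyFormulaZ2`.

**Crux (fixed, route decl).** For every conformal rectangle `R`: Cardy for the crude embedded
crossing event `embDomainCrossing squareLatticeEmbedding.z R.carrier δ (R.arc 0) (R.arc 2)` under
`P_{1/2}` on `ℤ²` implies Cardy for G02's `bondDomainCrossingProb R`.

**Line (same-domain squeeze, per `R`).** Upper: a G02 crossing at mesh `δ` IS a crude crossing at
parameter `δ/√2` (`stub_discrete_le_crude`; tree: `bondDomainCrossingProb_le_crude`). Lower: with a
square model `Φ` of `R` (`exists_isSquareModel`, Schoenflies) and `H = (i·) ∘ Φ`, the quad of `R` is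
`Q₀ = rectQuad H 1 1`; Schramm–Smirnov's Lemma 5.1 (PROVED in tree for bond-`ℤ²`,
`SchrammSmirnov2011_lemma_5_1_holds`) gives, through `Quad.continuity_of_lemma_5_1`, quads
`Q' < Q₀ < Q''` with `P[Q' crossed ∧ Q'' not crossed] ≤ ε/4` for ALL small meshes — the uniform
same-domain continuity that replaces the boundary-RSW re-routing of the birth card (valid for wild
Jordan boundaries: lowest crossing + RSW). Then, for small `δ`,
`crude(δ/√2) ≤ P[Q_{1-s₁,1+s₁} ∈ S_ω] ≤ P[Q' crossed] ≤ P[Q'' crossed] + ε/4 ≤ P[Q_{1+s₂,1-s₂} ∈ S_ω] + ε/4 ≤ bond R δ + ε/4`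
by the tree's `MeckeFlipBridge.crude_subset_crossed`, the two domination-transfer stubs
(`stub_strictlyDominated_shrink`, `stub_strictlyDominated_stretch`: strict domination is an open
condition and `rectQuad H (1∓s) (1±s) → Q₀`), and the port `stub_crossed_subset_discrete`
(a crossing of the longer-and-narrower quad by the drawn open edges is an open `ℤ²`-path poking out
of `Ω̄` across the arcs `0, 2` and keeping off the arcs `1, 3`, hence — `stub_discreteCrossing_of_pathIn`,
Bollobás–Riordan Claim 19 on `ℤ²`, in tree — a G02 crossing of `Ω_δ`).

* `DiscretisationBridge_of` — the crux from the four stub statements (all four landed as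
  `Theorems/CardyBondTriangularDiscretisationBridgeStub*.lean`, imported here).
* `DiscretisationBridge_proof` — the shared item's decl in its primary route file
  (`…Theses.CardyIsoradial.DiscretisationBridge`); `DiscretisationBridge_skeleton` — this route's
  decl (`…Theses.CardyBondTriangular.DiscretisationBridge`); both hypothesis-free and sorry-free.

References: O. Schramm, S. Smirnov, *On the scaling limits of planar percolation*, Ann. Probab. 39
(2011), §1.3, Lemma 5.1, Lemma 6.1; B. Bollobás, O. Riordan, *Percolation* (2006), Ch. 7, Lemma 14,
Claim 19 p. 192, remark p. 195; S. Smirnov, C. R. Acad. Sci. Paris 333 (2001), §2.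
-/

namespace Summit.CriticalPhenomena.CardyFormulaZ2.Cruxes.DiscretisationBridge.Birth

open Filter Topology Set MeasureTheory Metric
open scoped ENNReal unitInterval
open Literature.Probability.Percolation hiding cardyFunction
open Literature.Probability.Percolation.QuadCrossing
open Literature.Probability.RandomPlanarGeometry hiding cardyFunction
open Literature.Probability.LatticeModels
open Summit.CriticalPhenomena.CardyFormulaZ2.Theorems

/-- **Assembly.** The four stub statements give the crux: upper half from stub 1 and the crude
hypothesis reparametrised along `δ ↦ δ/√2`; lower half by the chain
`crude(δ/√2) ≤ P[Q' crossed] ≤ P[Q'' crossed] + ε/4 ≤ bond R δ + ε/4` (square model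
`exists_isSquareModel`, Schramm–Smirnov Lemma 5.1 continuity `Quad.continuity_of_lemma_5_1` with
`SchrammSmirnov2011_lemma_5_1_holds`, `MeckeFlipBridge.crude_subset_crossed`, stubs 3, 4, 2).
[cite: SchrammSmirnov2011, §1.3 and Lemma 5.1] -/
theorem DiscretisationBridge_of
    (h₁ : ∀ (R : Literature.Probability.RandomPlanarGeometry.ConformalRectangle) (δ : ℝ), 0 < δ →
      Literature.Probability.Percolation.bondDomainCrossingProb R δ ≤
        (Literature.Probability.Percolation.bondPercolation
            (Literature.Probability.LatticeModels.zdGraph 2)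
            Literature.Probability.Percolation.half).real
          (Literature.Probability.Percolation.embDomainCrossing
            Literature.Probability.LatticeModels.squareLatticeEmbedding.z R.carrier
            (δ / Real.sqrt 2) (R.arc 0) (R.arc 2)))
    (hport : ∀ (R : Literature.Probability.RandomPlanarGeometry.ConformalRectangle) (Φ : ℂ ≃ₜ ℂ),
      Literature.Probability.Percolation.IsSquareModel R Φ →
      ∀ (s : ℝ) (hs : 0 < s) (hs1 : s < 1),
        ∃ δ₀ : ℝ, 0 < δ₀ ∧ ∀ δ : ℝ, 0 < δ → δ < δ₀ →
          ∀ ω : Literature.Probability.Percolation.BondConfig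
              (Literature.Probability.LatticeModels.Site 2),
            Literature.Probability.Percolation.QuadCrossing.Quad.rectQuad
                ((Homeomorph.mulLeft₀ Complex.I Complex.I_ne_zero).trans Φ) (1 + s) (1 - s)
                (add_pos one_pos hs) (sub_pos.2 hs1) (fun _ => Set.mem_univ _) ∈
              Literature.Probability.Percolation.z2QuadConfig Set.univ δ ω →
            ω ∈ Literature.Probability.Percolation.discreteCrossing R.carrier δ (R.arc 0)
              (R.arc 2))
    (hshrink : ∀ (H : ℂ ≃ₜ ℂ)
      (Q' : Literature.Probability.Percolation.QuadCrossing.Quad (Set.univ : Set ℂ)),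
      Literature.Probability.Percolation.QuadCrossing.Quad.StrictlyDominated Q'
          (Literature.Probability.Percolation.QuadCrossing.Quad.rectQuad H 1 1 one_pos one_pos
            (fun _ => Set.mem_univ _)) →
        ∃ (s : ℝ) (hs : 0 < s) (hs1 : s < 1), s ≤ 1 / 2 ∧
          Literature.Probability.Percolation.QuadCrossing.Quad.StrictlyDominated Q'
            (Literature.Probability.Percolation.QuadCrossing.Quad.rectQuad H (1 - s) (1 + s)
              (sub_pos.2 hs1) (add_pos one_pos hs) (fun _ => Set.mem_univ _)))
    (hstretch : ∀ (H : ℂ ≃ₜ ℂ)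
      (Q'' : Literature.Probability.Percolation.QuadCrossing.Quad (Set.univ : Set ℂ)),
      Literature.Probability.Percolation.QuadCrossing.Quad.StrictlyDominated
          (Literature.Probability.Percolation.QuadCrossing.Quad.rectQuad H 1 1 one_pos one_pos
            (fun _ => Set.mem_univ _)) Q'' →
        ∃ (s : ℝ) (hs : 0 < s) (hs1 : s < 1), s ≤ 1 / 2 ∧
          Literature.Probability.Percolation.QuadCrossing.Quad.StrictlyDominated
            (Literature.Probability.Percolation.QuadCrossing.Quad.rectQuad H (1 + s) (1 - s)
              (add_pos one_pos hs) (sub_pos.2 hs1) (fun _ => Set.mem_univ _)) Q'') :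
    Summit.CriticalPhenomena.CardyFormulaZ2.Theses.CardyBondTriangular.DiscretisationBridge := by
  intro R hR φ x hφ
  -- the crude Cardy hypothesis, reparametrised along `δ ↦ δ/√2 : 𝓝[>] 0 → 𝓝[>] 0`
  have hq : Tendsto (fun δ : ℝ => (bondPercolation (zdGraph 2) half).real
      (embDomainCrossing squareLatticeEmbedding.z R.carrier (δ / Real.sqrt 2) (R.arc 0) (R.arc 2)))
      (𝓝[>] (0 : ℝ))
      (𝓝 (Literature.Probability.RandomPlanarGeometry.cardyFunction (crossRatio x))) :=
    (hR φ x hφ).comp tendsto_div_sqrt_two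
  rw [Metric.tendsto_nhds]
  intro ε hε
  have hε4 : 0 < ε / 4 := by positivity
  -- the square model of `R`, the quad of `R`, and Schramm–Smirnov's Lemma 5.1 continuity
  obtain ⟨Φ, hΦ⟩ := exists_isSquareModel R
  obtain ⟨Q', Q'', h', h'', δ₁, hδ₁, hcont⟩ :=
    Quad.continuity_of_lemma_5_1 SchrammSmirnov2011_lemma_5_1_holds
      (Quad.rectQuad ((Homeomorph.mulLeft₀ Complex.I Complex.I_ne_zero).trans Φ) 1 1 one_pos
        one_pos (fun _ => mem_univ _)) (ENNReal.ofReal (ε / 4)) (ENNReal.ofReal_pos.2 hε4)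
  obtain ⟨s₁, hs₁, hs₁1, hs₁h, hdom₁⟩ :=
    hshrink ((Homeomorph.mulLeft₀ Complex.I Complex.I_ne_zero).trans Φ) Q' h'
  obtain ⟨s₂, hs₂, hs₂1, -, hdom₂⟩ :=
    hstretch ((Homeomorph.mulLeft₀ Complex.I Complex.I_ne_zero).trans Φ) Q'' h''
  obtain ⟨δ₂, hδ₂, hcrude⟩ := MeckeFlipBridge.crude_subset_crossed hΦ hs₁ hs₁h
  obtain ⟨δ₃, hδ₃, hp⟩ := hport R Φ hΦ s₂ hs₂ hs₂1
  -- eventualities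
  have hA : ∀ᶠ δ in 𝓝[>] (0 : ℝ), dist ((bondPercolation (zdGraph 2) half).real
      (embDomainCrossing squareLatticeEmbedding.z R.carrier (δ / Real.sqrt 2) (R.arc 0) (R.arc 2)))
      (Literature.Probability.RandomPlanarGeometry.cardyFunction (crossRatio x)) < ε / 4 :=
    (Metric.tendsto_nhds.1 hq) (ε / 4) hε4
  have hS : ∀ᶠ δ in 𝓝[>] (0 : ℝ), δ < min δ₁ (min δ₂ δ₃) :=
    mem_nhdsWithin_of_mem_nhds (Iio_mem_nhds (lt_min hδ₁ (lt_min hδ₂ hδ₃)))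
  filter_upwards [hA, hS, self_mem_nhdsWithin] with δ hAδ hSδ hδ
  have hδ0 : (0 : ℝ) < δ := hδ
  have hδ₁' : δ < δ₁ := hSδ.trans_le (min_le_left _ _)
  have hδ₂' : δ < δ₂ := hSδ.trans_le ((min_le_right _ _).trans (min_le_left _ _))
  have hδ₃' : δ < δ₃ := hSδ.trans_le ((min_le_right _ _).trans (min_le_right _ _))
  -- upper half: a G02 crossing is a crude crossing
  have hup := h₁ R δ hδ0
  have h22 : Real.sqrt 2 ≤ 2 := Real.sqrt_two_lt_three_halves.le.trans (by norm_num)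
  -- lower half, step (a): a crude crossing crosses `Q_{1-s₁,1+s₁}`, hence `Q'`
  have hae : ∀ᵐ ω ∂bondPercolation (zdGraph 2) half, ω ⊆ (zdGraph 2).edgeSet :=
    ae_subset_edgeSet (zdGraph 2) half
  have hstep1 : (bondPercolation (zdGraph 2) half).real
      (embDomainCrossing squareLatticeEmbedding.z R.carrier (δ / Real.sqrt 2) (R.arc 0) (R.arc 2)) ≤
      (bondPercolation (zdGraph 2) half).real
        {ω | ∃ K, Q'.IsCrossing K ∧ K ⊆ openEdgeUnion δ ω} := by
    simp only [measureReal_def]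
    refine ENNReal.toReal_mono (measure_ne_top _ _) (measure_mono_ae ?_)
    filter_upwards [hae] with ω hω
    intro hωcr
    rw [embDomainCrossing_div_sqrt_two] at hωcr
    have hωcr' : ω ∈ openCrossing {y : Site 2 | meshPoint δ y ∈ R.carrier}
        {u | infDist (meshPoint δ u) (R.arc 0) ≤ 2 * δ}
        {v | infDist (meshPoint δ v) (R.arc 2) ≤ 2 * δ} := by
      refine openCrossing_mono Subset.rfl (fun u hu => ?_) (fun v hv => ?_) hωcr
      · exact le_trans (b := Real.sqrt 2 * δ) hu (mul_le_mul_of_nonneg_right h22 hδ0.le)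
      · exact le_trans (b := Real.sqrt 2 * δ) hv (mul_le_mul_of_nonneg_right h22 hδ0.le)
    have hmem := hcrude δ hδ0 hδ₂' ω hω hωcr'
    have hmem' : Quad.rectQuad ((Homeomorph.mulLeft₀ Complex.I Complex.I_ne_zero).trans Φ)
        (1 - s₁) (1 + s₁) (sub_pos.2 hs₁1) (add_pos one_pos hs₁) (fun _ => mem_univ _) ∈
        closure {Q : Quad (univ : Set ℂ) | ∃ K, Q.IsCrossing K ∧ K ⊆ openEdgeUnion δ ω} := by
      rw [← coe_z2QuadConfig]
      exact hmem
    exact Quad.exists_isCrossing_of_mem_closure hdom₁ hmem'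
  -- step (b): Schramm–Smirnov continuity, `P[Q' crossed] ≤ P[Q'' crossed] + ε/4`
  have hstep2 : (bondPercolation (zdGraph 2) half).real
        {ω | ∃ K, Q'.IsCrossing K ∧ K ⊆ openEdgeUnion δ ω} ≤
      (bondPercolation (zdGraph 2) half).real
        {ω | ∃ K, Q''.IsCrossing K ∧ K ⊆ openEdgeUnion δ ω} + ε / 4 := by
    have hdiff : (bondPercolation (zdGraph 2) half).real
        ({ω | ∃ K, Q'.IsCrossing K ∧ K ⊆ openEdgeUnion δ ω} \
          {ω | ∃ K, Q''.IsCrossing K ∧ K ⊆ openEdgeUnion δ ω}) ≤ ε / 4 := by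
      rw [measureReal_def]
      exact ENNReal.toReal_le_of_le_ofReal hε4.le (hcont δ hδ0 hδ₁')
    calc (bondPercolation (zdGraph 2) half).real
          {ω | ∃ K, Q'.IsCrossing K ∧ K ⊆ openEdgeUnion δ ω}
        ≤ (bondPercolation (zdGraph 2) half).real
            ({ω | ∃ K, Q''.IsCrossing K ∧ K ⊆ openEdgeUnion δ ω} ∪
              ({ω | ∃ K, Q'.IsCrossing K ∧ K ⊆ openEdgeUnion δ ω} \
                {ω | ∃ K, Q''.IsCrossing K ∧ K ⊆ openEdgeUnion δ ω})) :=
          measureReal_mono (fun ω hω => by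
            by_cases hω'' : ω ∈ {ω | ∃ K, Q''.IsCrossing K ∧ K ⊆ openEdgeUnion δ ω}
            · exact Or.inl hω''
            · exact Or.inr ⟨hω, hω''⟩)
      _ ≤ (bondPercolation (zdGraph 2) half).real
            {ω | ∃ K, Q''.IsCrossing K ∧ K ⊆ openEdgeUnion δ ω} +
          (bondPercolation (zdGraph 2) half).real
            ({ω | ∃ K, Q'.IsCrossing K ∧ K ⊆ openEdgeUnion δ ω} \
              {ω | ∃ K, Q''.IsCrossing K ∧ K ⊆ openEdgeUnion δ ω}) := measureReal_union_le _ _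
      _ ≤ _ := by linarith
  -- step (c): a crossing of `Q''` crosses `Q_{1+s₂,1-s₂}`, hence (port) is a G02 crossing
  have hstep3 : (bondPercolation (zdGraph 2) half).real
        {ω | ∃ K, Q''.IsCrossing K ∧ K ⊆ openEdgeUnion δ ω} ≤ bondDomainCrossingProb R δ := by
    rw [bondDomainCrossingProb_eq_measureReal]
    refine measureReal_mono ?_
    rintro ω ⟨K, hK, hKO⟩
    obtain ⟨K₂, hK₂K, hK₂⟩ := hdom₂.dominated K hK
    exact hp δ hδ0 hδ₃' ω (mem_z2QuadConfig_of_isCrossing hK₂ (hK₂K.trans hKO))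
  -- squeeze
  rw [Real.dist_eq, abs_lt] at hAδ ⊢
  obtain ⟨hA1, hA2⟩ := hAδ
  constructor
  · linarith
  · linarith

/-- **`DiscretisationBridge` (stmt-CriticalPhenomena-0787), the shared item's decl in its primary
route file `CardyIsoradial`, proved**: on `ℤ²` at `p = 1/2`, for every conformal rectangle, Cardy's
formula for the crude embedded crossing event implies Cardy's formula for G02's
`bondDomainCrossingProb` — `DiscretisationBridge_of` applied to the four landed stubs (the two
route decls are definitionally the same statement).
[cite: SchrammSmirnov2011, Lemma 5.1] [cite: BollobasRiordan2006, Ch. 7 Claim 19 p. 192 and remark p. 195] -/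
theorem DiscretisationBridge_proof :
    Summit.CriticalPhenomena.CardyFormulaZ2.Theses.CardyIsoradial.DiscretisationBridge :=
  DiscretisationBridge_of stub_discrete_le_crude stub_crossed_subset_discrete
    stub_strictlyDominated_shrink stub_strictlyDominated_stretch

/-- **`DiscretisationBridge` (stmt-CriticalPhenomena-0787), route `CardyBondTriangular`'s decl,
proved** (same statement and proof as `DiscretisationBridge_proof`).
[cite: SchrammSmirnov2011, Lemma 5.1] [cite: BollobasRiordan2006, Ch. 7 Claim 19 p. 192 and remark p. 195] -/
theorem DiscretisationBridge_skeleton :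
    Summit.CriticalPhenomena.CardyFormulaZ2.Theses.CardyBondTriangular.DiscretisationBridge :=
  DiscretisationBridge_of stub_discrete_le_crude stub_crossed_subset_discrete
    stub_strictlyDominated_shrink stub_strictlyDominated_stretch

end Summit.CriticalPhenomena.CardyFormulaZ2.Cruxes.DiscretisationBridge.Birth
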